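import Summits.QuantumFields.BalabanUV.T4Continuum.Support.ShellMeasureWindowCovariantAxial

/-!
# `T4Continuum.ShellMeasureWindowCovariantPullback` — the per-fibre (M1) hypotheses of `ShellMeasureWindowCovariant`
# / `…Axial` PULLED BACK ALONG THE NORMALISATION: they are (M1) statements about the configuration law `μ` ITSELF
# (for the axial instance: product Haar `dU` on ALL bonds of `T^{(j)}`) tilted by an explicit density — the field
# RE-NORMALISED to a frozen value of its average — i.e. the input shape of the realized END-II; no unit-fibre law,
# no chart of a fibre is left in the statement
(cell `pub-balaban`, sub-cell `t4`, spine estimate NE7c (node U5b); NE7c ROUND-2 crew `t4-ne7c-formalise-*`, seat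
leaf-10 (gen 4), third file of the gen after p213243 / p213512; ADDITIVE — imports `ShellMeasureWindowCovariantAxial`
only, modifies nothing; 0 `def`, 0 sorry, 0 cite)

HONEST FRAMING.  Finite four-torus programme, rung (B)+1 only — NOT infinite volume, NOT a mass gap, NOT the Clay
problem, NOT summit progress; (B), `BetaPertHyp`, (B^μ) are not consumed.  NE7c ⇐ the named binders (trigger c3);
NE7c NOT PRINTED, NOT proved; spine PROVED 0/9 before and after.  STRUCTURAL BOOKKEEPING (a push-forward is measure
preserving onto its image law) — no estimate, no `def` (c2), `[folklore]` throughout.  HONEST DEPENDENCY (cell):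
continuum YM on T⁴ ⇐ BetaPertH ∧ nine spine estimates (0/9 proved); BetaPertH ⇐ (D1) ∧ (D4) ∧ CAP+tail; G-an2-4
gates asym, D1 and NE2/3/4.

THE POINT.  Files 6/7 reduce (M1) for the windowed realized slot law to (M1), per frozen (exterior point `z`, average
value `g`), of the UNIT-FIBRE LAW `ν₁ = μ.map W` tilted by a density; their headers display «a chart of ONE unit fibre»
((CH)_fib) as what the per-fibre statement still needs before E2′'s level data apply.  But `ν₁` is BY CONSTRUCTION the
image of `μ` under the normalisation `W x = act (M x)⁻¹ x`, so every (M1) statement about `ν₁.withDensity F` with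
variable `u'` is implied by the (M1) statement about `μ.withDensity (F ∘ W)` with variable `u' ∘ W`
(`T4ShellMeasureDet.slotAntiConcentration_withDensity_map` BY NAME), and `act g (W x) = act ((M x)⁻¹ g) x` is the
configuration RE-NORMALISED TO AVERAGE `g` (`average_renormalise`).  Hence:
* §1 (abstract, the setting of `ShellMeasureWindowCovariant`): `act_normalise`, `average_renormalise`,
  `measurePreserving_normalise`, `slotAC_unitFibre_of_pullback`, **`slotAC_covariant_of_renormalised`** ((M1) for
  `((μ.prod ζ).withDensity G)` ⇐ ∀ z g, (M1) for `μ.withDensity (x ↦ G (act ((M x)⁻¹ g) x, z))` with variable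
  `x ↦ u (act ((M x)⁻¹ g) x, z)`), `window_renormalise` (the window factor pulled back is print's ORIGINAL window
  `1{d(x, act (M x) c) < r}` — the normalisation is undone on it by `act`-invariance of `d`), and the window END
  **`slotAC_covariantWindow_of_renormalised`**;
* §2 (the axial instance, the setting of `ShellMeasureWindowCovariantAxial`): `renormalise_axial` (the re-normalised
  field is `U · k_{(Ū U)⁻¹ V}` — the last bond of the line of `c` becomes `(U(b₀)⋯U(b_{L−2}))⁻¹ · V c`, every other
  bond kept; its axial average IS `V`: `axialAvg_renormalise`), **`slotAC_axial_of_renormalised`** and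
  **`slotAC_axialWindow_of_renormalised`**: (M1) for the `dU`-realized windowed slot law ⇐ ∀ z V, (M1) for
  `dU.withDensity (U ↦ 1{δ(b ↦ U b·(c_z b·k_{Ū U} b)⁻¹) < r} · G₀ (U · k_{(Ū U)⁻¹ V}, z))` with variable
  `U ↦ u (U · k_{(Ū U)⁻¹ V}, z)` — an (M1) statement about PRODUCT HAAR `dU = fieldMeasure P j G` ON ALL BONDS with an
  explicit measurable density: the input SHAPE of the realized END-II (`ShellMeasureRootCompositionLevelZero.
  slotAC_realized_su2_of_levelData_cube`, `ShellMeasureWindowFixedCentre.…_raw`) — NO unit-fibre law, NO chart binder.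
WHAT REMAINS (displayed, c3-honest, unchanged in substance): E2′'s level data + dictionary for THAT density — in
particular the window's last-bond term reads, on `dU`, as a ball condition on `U(last)·(centre·k_{Ū U})(last)⁻¹`, i.e.
on the PREFIX TRANSPORT `U(b₀)⋯U(b_{L−2})` relative to the centre (nonlinear in the block variables): the co-test
SHAPE E2′'s `hJ`/`hJW` must accept — a statement about E2′'s binders, not a measure binder.  (M1) per slot stays THE
wall; nothing printed is asserted; no instance of SM-L1/L3/L4/L6 at any `j ≥ 1`; (T) for [Balaban1985Averaging]'s
block average NOT claimed.
-/

noncomputable section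

open Set Function MeasureTheory MeasureTheory.Measure

namespace Summit.QuantumFields.BalabanUV.T4Continuum.ShellMeasureWindowCovariantPullback

open scoped ENNReal
open Literature.MathematicalPhysics.QuantumFieldTheory.Balaban1983to89
open T4ShellMeasure (SlotAntiConcentration)
open T4ShellMeasureDet (slotAntiConcentration_withDensity_map)
open AveragingRT (line pathProd axialAvg last_injective)
open ShellMeasureWindowCovariant (measurable_normalise slotAC_covariant_of_fibrewise
  slotAC_covariantWindow_of_fibrewise)
open ShellMeasureWindowCovariantAxial (extend_last_mul extend_last_inv lastAct_one lastAct_mul axialAvg_lastAct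
  measurable_lastAct measurable_axialAvg_pi measurePreserving_lastAct isMulLeftInvariant_haar normalise_last)

/-! ## §1 Abstract: the per-fibre (M1) pulled back to the configuration law -/

section Abstract

variable {B : Type*} [Group B] {X : Type*} {act : B → X → X} {M : X → B}

/-- translating the normalised configuration: `act g (W x) = act ((M x)⁻¹ g) x`. [folklore] -/
theorem act_normalise (hmul : ∀ g h x, act (g * h) x = act h (act g x)) (g : B) (x : X) :
    act g (act (M x)⁻¹ x) = act ((M x)⁻¹ * g) x := by
  rw [← hmul]

/-- the RE-NORMALISED configuration `act ((M x)⁻¹ g) x` has average `g`. [folklore] -/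
theorem average_renormalise (hcov : ∀ g x, M (act g x) = M x * g) (g : B) (x : X) :
    M (act ((M x)⁻¹ * g) x) = g := by
  rw [hcov, mul_inv_cancel_left]

/-- for an `act`-invariant `d`, the distance of the normalised configuration to a point `c` is the distance of the
configuration to the translate `act (M x) c` — the window factor pulled back along the normalisation is print's
ORIGINAL window about the covariant centre. [folklore] -/
theorem window_renormalise (hone : ∀ x, act 1 x = x) (hmul : ∀ g h x, act (g * h) x = act h (act g x))
    {d : X → X → ℝ} (hd : ∀ g x y, d (act g x) (act g y) = d x y) (c : X) (x : X) :
    d (act (M x)⁻¹ x) c = d x (act (M x) c) := by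
  rw [← hd (M x) (act (M x)⁻¹ x) c, ← hmul, inv_mul_cancel, hone]

variable [MeasurableSpace B] [MeasurableInv B] [MeasurableSpace X] (μ : Measure X)

/-- the normalisation is measure preserving onto the unit-fibre law — by definition of the latter. [folklore] -/
theorem measurePreserving_normalise (hact : Measurable fun p : B × X => act p.1 p.2) (hM : Measurable M) :
    MeasurePreserving (fun x => act (M x)⁻¹ x) μ (μ.map fun x => act (M x)⁻¹ x) :=
  ⟨measurable_normalise hact hM, rfl⟩

/-- **(M1) ON THE UNIT FIBRE ⇐ (M1) ON THE CONFIGURATION LAW, PULLED BACK.**  For any measurable density `F` and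
variable `u'` on `X`: (M1) for `ν₁.withDensity F`, `u'` FOLLOWS from (M1) for `μ.withDensity (F ∘ W)`, `u' ∘ W`,
SAME `θ ρ D`. [folklore] -/
theorem slotAC_unitFibre_of_pullback (hact : Measurable fun p : B × X => act p.1 p.2) (hM : Measurable M)
    {F : X → ℝ≥0∞} (hF : Measurable F) {u' : X → ℝ} (hu' : Measurable u') {θ ρ D : ℝ}
    (h : SlotAntiConcentration (μ.withDensity fun x => F (act (M x)⁻¹ x)) (fun x => u' (act (M x)⁻¹ x)) θ ρ D) :
    SlotAntiConcentration ((μ.map fun x => act (M x)⁻¹ x).withDensity F) u' θ ρ D :=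
  slotAntiConcentration_withDensity_map (measurePreserving_normalise μ hact hM) hF hu' h

variable [MeasurableMul₂ B] [IsFiniteMeasure μ]

/-- **(M1) FOR THE REALIZED SLOT LAW ⇐ (M1) FOR THE CONFIGURATION LAW RE-NORMALISED TO EACH FROZEN AVERAGE VALUE.**
`((μ.prod ζ).withDensity G)` satisfies (M1) as soon as, for every exterior point `z` and every `g`, the configuration
law `μ` tilted by `x ↦ G (act ((M x)⁻¹ g) x, z)` does, with variable `x ↦ u (act ((M x)⁻¹ g) x, z)`, SAME `θ ρ D` —
no unit-fibre law in the statement. [folklore] -/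
theorem slotAC_covariant_of_renormalised (η : Measure B) [IsProbabilityMeasure η] [η.IsMulLeftInvariant]
    {Z : Type*} [MeasurableSpace Z] (ζ : Measure Z) [SFinite ζ]
    (hact : Measurable fun p : B × X => act p.1 p.2) (hone : ∀ x, act 1 x = x)
    (hmul : ∀ g h x, act (g * h) x = act h (act g x)) (hinv : ∀ g, MeasurePreserving (act g) μ μ)
    (hM : Measurable M) (hcov : ∀ g x, M (act g x) = M x * g) {G : X × Z → ℝ≥0∞} (hG : Measurable G)
    {u : X × Z → ℝ} (hu : Measurable u) {θ ρ D : ℝ}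
    (h : ∀ (z : Z) (g : B), SlotAntiConcentration (μ.withDensity fun x => G (act ((M x)⁻¹ * g) x, z))
      (fun x => u (act ((M x)⁻¹ * g) x, z)) θ ρ D) :
    SlotAntiConcentration ((μ.prod ζ).withDensity G) u θ ρ D := by
  refine slotAC_covariant_of_fibrewise μ η ζ hact hone hmul hinv hM hcov hG hu fun z g => ?_
  have hag : Measurable fun x : X => act g x := (hinv g).measurable
  refine slotAC_unitFibre_of_pullback μ hact hM ((hG.comp measurable_prodMk_right).comp hag)
    ((hu.comp measurable_prodMk_right).comp hag) ?_
  simpa only [comp_apply, act_normalise hmul] using h z g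

/-- **END — WINDOW ABOUT A COVARIANT CENTRE, PULLED BACK.**  (M1) for
`((μ.prod ζ).withDensity (1{d(x, act (M x) (c z)) < r} · G₀))` FOLLOWS from: ∀ z g, (M1) for `μ` tilted by
`x ↦ 1{d(x, act (M x) (c z)) < r} · G₀ (act ((M x)⁻¹ g) x, z)` — print's ORIGINAL window factor (unchanged by the
pull-back, `window_renormalise`) times the weights at the configuration re-normalised to average `g` — with variable
`x ↦ u (act ((M x)⁻¹ g) x, z)`, SAME `θ ρ D`. [folklore] -/
theorem slotAC_covariantWindow_of_renormalised (η : Measure B) [IsProbabilityMeasure η] [η.IsMulLeftInvariant]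
    {Z : Type*} [MeasurableSpace Z] (ζ : Measure Z) [SFinite ζ] [MeasurableSingletonClass B]
    (hact : Measurable fun p : B × X => act p.1 p.2) (hone : ∀ x, act 1 x = x)
    (hmul : ∀ g h x, act (g * h) x = act h (act g x)) (hinv : ∀ g, MeasurePreserving (act g) μ μ)
    (hM : Measurable M) (hcov : ∀ g x, M (act g x) = M x * g) {d : X → X → ℝ}
    (hd : ∀ g x y, d (act g x) (act g y) = d x y) (hdm : Measurable fun p : X × X => d p.1 p.2)
    {c : Z → X} (hc : Measurable c) (r : ℝ) {G₀ : X × Z → ℝ≥0∞} (hG₀ : Measurable G₀) {u : X × Z → ℝ}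
    (hu : Measurable u) {θ ρ D : ℝ}
    (h : ∀ (z : Z) (g : B), SlotAntiConcentration (μ.withDensity fun x =>
      {v | d v (act (M v) (c z)) < r}.indicator 1 x * G₀ (act ((M x)⁻¹ * g) x, z))
      (fun x => u (act ((M x)⁻¹ * g) x, z)) θ ρ D) :
    SlotAntiConcentration ((μ.prod ζ).withDensity fun p =>
      {x | d x (act (M x) (c p.2)) < r}.indicator 1 p.1 * G₀ p) u θ ρ D := by
  refine slotAC_covariantWindow_of_fibrewise μ η ζ hact hone hmul hinv hM hcov hd hdm hc r hG₀ hu fun z g => ?_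
  have hag : Measurable fun x : X => act g x := (hinv g).measurable
  have hball : MeasurableSet {v : X | d v (c z) < r} :=
    measurableSet_lt (hdm.comp (measurable_id.prodMk measurable_const)) measurable_const
  have hF : Measurable fun w : X => {v : X | d v (c z) < r}.indicator (1 : X → ℝ≥0∞) w * G₀ (act g w, z) :=
    (measurable_one.indicator hball).mul ((hG₀.comp measurable_prodMk_right).comp hag)
  refine slotAC_unitFibre_of_pullback μ hact hM hF ((hu.comp measurable_prodMk_right).comp hag) ?_
  -- the pulled-back density: window factor = the original window, weights at the re-normalised configuration
  have hwin : ∀ x : X, {v : X | d v (c z) < r}.indicator (1 : X → ℝ≥0∞) (act (M x)⁻¹ x) =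
      {v : X | d v (act (M v) (c z)) < r}.indicator 1 x := fun x => by
    by_cases hx : d x (act (M x) (c z)) < r
    · rw [indicator_of_mem (show act (M x)⁻¹ x ∈ {v : X | d v (c z) < r} by
          rw [mem_setOf_eq, window_renormalise hone hmul hd]; exact hx),
        indicator_of_mem (show x ∈ {v : X | d v (act (M v) (c z)) < r} from hx)]
      rfl
    · rw [indicator_of_notMem (show act (M x)⁻¹ x ∉ {v : X | d v (c z) < r} by
          rw [mem_setOf_eq, window_renormalise hone hmul hd]; exact hx),
        indicator_of_notMem (show x ∉ {v : X | d v (act (M v) (c z)) < r} from hx)]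
  simpa only [comp_apply, hwin, act_normalise hmul] using h z g

end Abstract

/-! ## §2 The axial instance: (M1) hypotheses on product Haar `dU` itself -/

section Axial

variable {P : Params} {j : ℕ} {G : Type*} [GaugeGroup G]

/-- **THE RE-NORMALISED FIELD.**  Translating the normalised field `U · k_{(Ū U)⁻¹}` by `k_V` gives `U · k_{(Ū U)⁻¹ V}`:
the last bond of the line of every `c` becomes `U(last c) · (Ū U c)⁻¹ · V c`, every other bond is kept. [folklore] -/
theorem renormalise_axial (hj : j + 1 ≤ P.m + P.K) (V : PBond P (j+1) → G) (U : GaugeField P j G) :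
    (fun b => (U b * Function.extend (fun c : PBond P (j+1) => line c (P.L - 1)) (fun c => axialAvg U c)⁻¹
      (fun _ => 1) b) * Function.extend (fun c : PBond P (j+1) => line c (P.L - 1)) V (fun _ => 1) b) =
      fun b => U b * Function.extend (fun c : PBond P (j+1) => line c (P.L - 1))
        ((fun c => axialAvg U c)⁻¹ * V) (fun _ => 1) b := by
  funext b
  rw [extend_last_mul hj, mul_assoc]

/-- on the last bond of the line of `c` the re-normalised field reads `(U(b₀)⋯U(b_{L−2}))⁻¹ · V c`. [folklore] -/
theorem renormalise_axial_last (hj : j + 1 ≤ P.m + P.K) (V : PBond P (j+1) → G) (U : GaugeField P j G)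
    (c : PBond P (j+1)) :
    U (line c (P.L - 1)) * Function.extend (fun c : PBond P (j+1) => line c (P.L - 1))
      ((fun c => axialAvg U c)⁻¹ * V) (fun _ => 1) (line c (P.L - 1)) = (pathProd U c (P.L - 1))⁻¹ * V c := by
  rw [extend_last_mul hj, ← mul_assoc, normalise_last hj, (last_injective hj).extend_apply]

/-- the re-normalised field HAS axial average `V`. [folklore] -/
theorem axialAvg_renormalise (hj : j + 1 ≤ P.m + P.K) (V : PBond P (j+1) → G) (U : GaugeField P j G) :
    (fun c => axialAvg (fun b => U b * Function.extend (fun c : PBond P (j+1) => line c (P.L - 1))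
      ((fun c => axialAvg U c)⁻¹ * V) (fun _ => 1) b) c) = V := by
  have h := axialAvg_lastAct hj ((fun c => axialAvg U c)⁻¹ * V) U
  rw [h, mul_inv_cancel_left]

variable [MeasurableSpace G] [MeasurableMul₂ G] [MeasurableInv G] [HaarData G]

/-- **(M1) FOR A `dU`-REALIZED SLOT LAW ⇐ (M1) FOR `dU` RE-NORMALISED TO EACH FROZEN COARSE FIELD.**
`((dU.prod ζ).withDensity G)` satisfies (M1) as soon as, for every exterior point `z` and coarse field `V`, PRODUCT HAAR
`dU` ON ALL BONDS tilted by `U ↦ G (U · k_{(Ū U)⁻¹ V}, z)` does, with variable `U ↦ u (U · k_{(Ū U)⁻¹ V}, z)`, SAME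
`θ ρ D` — the input SHAPE of the realized END-II; no unit-fibre law, no chart binder. [folklore] -/
theorem slotAC_axial_of_renormalised (hj : j + 1 ≤ P.m + P.K) {Z : Type*} [MeasurableSpace Z] (ζ : Measure Z)
    [SFinite ζ] {G₁ : GaugeField P j G × Z → ℝ≥0∞} (hG₁ : Measurable G₁) {u : GaugeField P j G × Z → ℝ}
    (hu : Measurable u) {θ ρ D : ℝ}
    (h : ∀ (z : Z) (V : PBond P (j+1) → G), SlotAntiConcentration
      ((fieldMeasure P j G).withDensity fun U : GaugeField P j G =>
        G₁ ((fun b => U b * Function.extend (fun c : PBond P (j+1) => line c (P.L - 1))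
          ((fun c => axialAvg U c)⁻¹ * V) (fun _ => 1) b), z))
      (fun U => u ((fun b => U b * Function.extend (fun c : PBond P (j+1) => line c (P.L - 1))
          ((fun c => axialAvg U c)⁻¹ * V) (fun _ => 1) b), z)) θ ρ D) :
    SlotAntiConcentration (((fieldMeasure P j G).prod ζ).withDensity G₁) u θ ρ D := by
  haveI := isMulLeftInvariant_haar (G := G)
  refine slotAC_covariant_of_renormalised (B := PBond P (j+1) → G) (fieldMeasure P j G)
    (Measure.pi (fun _ : PBond P (j+1) => (HaarData.haar : Measure G))) ζ
    (act := fun (g : PBond P (j+1) → G) (U : GaugeField P j G) (b : PBond P j) =>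
      U b * Function.extend (fun c : PBond P (j+1) => line c (P.L - 1)) g (fun _ => 1) b)
    (M := fun (U : GaugeField P j G) (c : PBond P (j+1)) => axialAvg U c)
    (measurable_lastAct hj) lastAct_one (lastAct_mul hj) measurePreserving_lastAct measurable_axialAvg_pi
    (axialAvg_lastAct hj) hG₁ hu fun z V => ?_
  exact h z V

/-- **END — THE AXIAL INSTANCE OF (LR)_j, HYPOTHESES ON `dU` ITSELF.**  (M1) for the `dU`-realized slot law windowed by
ANY measurable gauge `δ` of the bondwise quotients about the COVARIANT centre `c_z · k_{Ū U}` (times weights `G₀`, times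
any s-finite exterior law) FOLLOWS from: ∀ z V, (M1) for `dU.withDensity (U ↦ 1{δ(b ↦ U b·(c_z b·k_{Ū U} b)⁻¹) < r} ·
G₀ (U · k_{(Ū U)⁻¹ V}, z))` with variable `U ↦ u (U · k_{(Ū U)⁻¹ V}, z)`, SAME `θ ρ D`.  CONDITIONAL on that (M1) —
an E2′-shaped statement on `fieldMeasure P j G`; the window's last-bond term is a ball condition on the prefix
transport (`renormalise_axial_last`), the co-test shape E2′ must accept; nothing printed is asserted. [folklore] -/
theorem slotAC_axialWindow_of_renormalised [MeasurableSingletonClass G] (hj : j + 1 ≤ P.m + P.K) {Z : Type*}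
    [MeasurableSpace Z] (ζ : Measure Z) [SFinite ζ] {δ : GaugeField P j G → ℝ} (hδ : Measurable δ)
    {c : Z → GaugeField P j G} (hc : Measurable c) (r : ℝ) {G₀ : GaugeField P j G × Z → ℝ≥0∞}
    (hG₀ : Measurable G₀) {u : GaugeField P j G × Z → ℝ} (hu : Measurable u) {θ ρ D : ℝ}
    (h : ∀ (z : Z) (V : PBond P (j+1) → G), SlotAntiConcentration
      ((fieldMeasure P j G).withDensity fun U : GaugeField P j G =>
        {U' : GaugeField P j G | δ (fun b => U' b * (c z b * Function.extend
          (fun c : PBond P (j+1) => line c (P.L - 1)) (fun c => axialAvg U' c) (fun _ => 1) b)⁻¹) < r}.indicator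
            1 U *
          G₀ ((fun b => U b * Function.extend (fun c : PBond P (j+1) => line c (P.L - 1))
            ((fun c => axialAvg U c)⁻¹ * V) (fun _ => 1) b), z))
      (fun U => u ((fun b => U b * Function.extend (fun c : PBond P (j+1) => line c (P.L - 1))
          ((fun c => axialAvg U c)⁻¹ * V) (fun _ => 1) b), z)) θ ρ D) :
    SlotAntiConcentration (((fieldMeasure P j G).prod ζ).withDensity fun p =>
      {U : GaugeField P j G | δ (fun b => U b * (c p.2 b * Function.extend (fun c : PBond P (j+1) => line c (P.L - 1))
        (fun c => axialAvg U c) (fun _ => 1) b)⁻¹) < r}.indicator 1 p.1 * G₀ p) u θ ρ D := by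
  haveI := isMulLeftInvariant_haar (G := G)
  have hd : ∀ (g : PBond P (j+1) → G) (x y : GaugeField P j G),
      δ (fun b => (x b * Function.extend (fun c : PBond P (j+1) => line c (P.L - 1)) g (fun _ => 1) b) *
        (y b * Function.extend (fun c : PBond P (j+1) => line c (P.L - 1)) g (fun _ => 1) b)⁻¹) =
      δ (fun b => x b * (y b)⁻¹) := fun g x y => by rw [ShellMeasureWindowCovariantAxial.quotient_lastAct]
  have hdm : Measurable fun p : GaugeField P j G × GaugeField P j G => δ (fun b => p.1 b * (p.2 b)⁻¹) :=
    hδ.comp (measurable_pi_iff.mpr fun b =>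
      ((measurable_pi_apply b).comp measurable_fst).mul ((measurable_pi_apply b).comp measurable_snd).inv)
  refine slotAC_covariantWindow_of_renormalised (B := PBond P (j+1) → G) (fieldMeasure P j G)
    (Measure.pi (fun _ : PBond P (j+1) => (HaarData.haar : Measure G))) ζ
    (act := fun (g : PBond P (j+1) → G) (U : GaugeField P j G) (b : PBond P j) =>
      U b * Function.extend (fun c : PBond P (j+1) => line c (P.L - 1)) g (fun _ => 1) b)
    (M := fun (U : GaugeField P j G) (c : PBond P (j+1)) => axialAvg U c)
    (measurable_lastAct hj) lastAct_one (lastAct_mul hj) measurePreserving_lastAct measurable_axialAvg_pi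
    (axialAvg_lastAct hj) (d := fun x y : GaugeField P j G => δ (fun b => x b * (y b)⁻¹)) hd hdm hc r hG₀ hu
    fun z V => ?_
  simpa only [renormalise_axial hj] using h z V

end Axial

end Summit.QuantumFields.BalabanUV.T4Continuum.ShellMeasureWindowCovariantPullback

end
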